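import Mathlib
import HarnessLib
import Summits.ValiantsHypothesis.ValiantsHypothesis.Theorems.LacunarySymmetroidMatrixDescartesStubVLawTwo

/-!
# ValiantsHypothesis / LacunarySymmetroid — crux `MatrixDescartes` (stmt-ValiantsHypothesis-18050, V1),
# LINE (A) «product_plus_one» (val-idea-25; card `Cruxes/MatrixDescartes/Ideas/product-plus-one.md`):
# the POSITIVE-COEFFICIENT RUNG `stub_posCoeffRung` (S3 of the card)

The product-plus-one class has determinant `∏_{j<m} f_j(x) + (−1)^{m−1} σ x^{m·d_{l₀}}` with `m` `K`-nomials
`f_j = Σ_l a_{jl} x^{d_l}` on a common support (card §First lemma, `PencilDetIdentity`).  Its first PROVED rung, uniform in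
`m` and `K` (card §Located laws, «A PROVED rung, K- and m-free [S3 `PosCoeffRung`]»; sketch
`Cruxes/MatrixDescartes/IDEATION_f_g0_ProductPlusOne_PowerSector.lean` §1 `ProductPlusOne.PosCoeffRung`):

* `card_pos_roots_prod_sub_monomial_le_two` — if every `a_{jl} ≥ 0` then, for EVERY real `c` and EVERY position `N`,
  `∏_j f_j − c·X^N` has at most two distinct positive zeros (indeed at most two counted with multiplicity,
  `countP_pos_roots_prod_sub_monomial_le_two`);
* `countP_pos_roots_prod_add_monomial_eq_zero` — and `∏_j f_j + c·X^N` (`c ≥ 0`) has none;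
* `countP_pos_roots_prod_sub_C_le_one` — at the bottom position `N = 0` (the sketch's shape) the sharp count is ONE
  (`countP_pos_roots_le_one_of_extreme`: a lone negative coefficient at an extreme position of the support);
* `posCoeffRung` — the sketch's `PosCoeffRung` VERBATIM (its `fewnomial d (a j)` unfolded to `∑ l, C (a j l) * X ^ (d l)`;
  position `N = 0`), so the line file can cite it by name with δ-unfolding only.

Mechanism (inertia-free, works for the NILPOTENT coupling of the class): the coefficient sequence of `∏_j f_j − c X^N` is
non-negative except possibly at the single index `N`, hence has at most two sign variations, and Descartes' rule of signs
(Mathlib `Polynomial.roots_countP_pos_le_signVariations`) bounds the positive zeros with multiplicity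
(`signVariations_le_two_of_coeff_nonneg_off`, by the `eraseLead` recursion `Polynomial.signVariations_eq_eraseLead_add_ite`).
The card's log-convexity proof (`s ↦ Σ_j log F_j(s) − N s − log c` convex) gives the same count; the rule of signs is its
algebraic shadow and needs no analysis.

HONEST FRAMING: a rung of LINE (A) in a restricted coefficient sector (all diagonal letters entrywise non-negative); NOT the
class law `stub_productPlusOneLaw` / `PPOPolyLaw`, not `ProductPlusOneMDR`, not `MatrixDescartes`, not Conjecture B;
`VP ≠ VNP` is NOT proved.  No definitions, no named facts; Mathlib + one tree file (`StubVLawTwo.card_filter_pos_le_countP`).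
-/

-- `Summit.ValiantsHypothesis.ValiantsHypothesis.…` is the tree's mandated single-conjunct layout (Sub = Summit).
set_option linter.dupNamespace false

namespace Summit.ValiantsHypothesis.ValiantsHypothesis.Theorems.LacunarySymmetroidMatrixDescartes

namespace ProductPlusOne

open Polynomial Finset
open scoped BigOperators

/-! ### Descartes' rule of signs with at most one negative coefficient -/

/-- A real polynomial with non-negative coefficients has no sign variation. [folklore] -/
theorem signVariations_eq_zero_of_coeff_nonneg :
    ∀ (n : ℕ) (Q : ℝ[X]), Q.support.card ≤ n → (∀ i, 0 ≤ Q.coeff i) → Q.signVariations = 0 := by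
  intro n
  induction n with
  | zero =>
    intro Q hQ _
    have h0 : Q = 0 := Polynomial.card_support_eq_zero.mp (by omega)
    rw [h0, signVariations_zero]
  | succ n ih =>
    intro Q hQ hnn
    by_cases hQ0 : Q = 0
    · rw [hQ0, signVariations_zero]
    have hE : Q.eraseLead.signVariations = 0 := by
      refine ih _ ?_ ?_
      · have := eraseLead_support_card_lt hQ0
        omega
      · intro i
        rw [eraseLead_coeff]
        split_ifs
        · exact le_rfl
        · exact hnn i
    rw [signVariations_eq_eraseLead_add_ite hQ0, hE, zero_add]
    have hlc : 0 < Q.leadingCoeff := lt_of_le_of_ne (hnn _) (Ne.symm (leadingCoeff_ne_zero.mpr hQ0))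
    have h2 : 0 ≤ SignType.sign Q.eraseLead.leadingCoeff := by
      rw [sign_nonneg_iff, leadingCoeff, eraseLead_coeff]
      split_ifs
      · exact le_rfl
      · exact hnn _
    rw [sign_pos hlc, if_neg]
    intro h
    rcases SignType.nonneg_iff.mp h2 with h3 | h3 <;> rw [h3] at h <;> exact absurd h (by decide)

/-- One possibly negative coefficient, in TOP position (nothing above it): at most one sign variation. [folklore] -/
theorem signVariations_le_one_of_top (Q : ℝ[X]) (N : ℕ) (hnn : ∀ i, i ≠ N → 0 ≤ Q.coeff i)
    (htop : ∀ i, N < i → Q.coeff i = 0) : Q.signVariations ≤ 1 := by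
  by_cases hQ0 : Q = 0
  · rw [hQ0, signVariations_zero]
    exact zero_le_one
  by_cases hN : 0 ≤ Q.coeff N
  · have h0 : Q.signVariations = 0 :=
      signVariations_eq_zero_of_coeff_nonneg _ Q le_rfl (fun i => by
        by_cases hi : i = N
        · rw [hi]; exact hN
        · exact hnn i hi)
    omega
  · push Not at hN
    have hdeg : Q.natDegree = N := by
      refine le_antisymm ?_ (le_natDegree_of_ne_zero hN.ne)
      exact (natDegree_le_iff_coeff_eq_zero).mpr (fun i hi => htop i hi)
    have hE : Q.eraseLead.signVariations = 0 := by
      refine signVariations_eq_zero_of_coeff_nonneg _ _ le_rfl (fun i => ?_)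
      rw [eraseLead_coeff]
      split_ifs with hi
      · exact le_rfl
      · exact hnn i (hdeg ▸ hi)
    rw [signVariations_eq_eraseLead_add_ite hQ0, hE, zero_add]
    split_ifs <;> simp

/-- One possibly negative coefficient, in BOTTOM position (nothing below it): at most one sign variation. [folklore] -/
theorem signVariations_le_one_of_bottom :
    ∀ (n : ℕ) (Q : ℝ[X]) (N : ℕ), Q.support.card ≤ n → (∀ i, i ≠ N → 0 ≤ Q.coeff i) →
      (∀ i, i < N → Q.coeff i = 0) → Q.signVariations ≤ 1 := by
  intro n
  induction n with
  | zero =>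
    intro Q N hQ _ _
    have h0 : Q = 0 := Polynomial.card_support_eq_zero.mp (by omega)
    rw [h0, signVariations_zero]
    exact zero_le_one
  | succ n ih =>
    intro Q N hQ hnn hbot
    by_cases hQ0 : Q = 0
    · rw [hQ0, signVariations_zero]
      exact zero_le_one
    by_cases hdeg : Q.natDegree ≤ N
    · -- then `Q` is the monomial `coeff Q N · X^N`
      have hmono : Q = monomial N (Q.coeff N) := by
        ext i
        rw [coeff_monomial]
        split_ifs with hi
        · rw [hi]
        · rcases lt_or_gt_of_ne (Ne.symm hi) with hlt | hgt
          · exact hbot i hlt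
          · exact coeff_eq_zero_of_natDegree_lt (lt_of_le_of_lt hdeg hgt)
      rw [hmono, signVariations_monomial]
      exact zero_le_one
    · push Not at hdeg
      have hlc : 0 < Q.leadingCoeff :=
        lt_of_le_of_ne (hnn _ hdeg.ne') (Ne.symm (leadingCoeff_ne_zero.mpr hQ0))
      have hnnE : ∀ j, j ≠ N → 0 ≤ Q.eraseLead.coeff j := by
        intro j hj
        rw [eraseLead_coeff]
        split_ifs
        · exact le_rfl
        · exact hnn j hj
      have hbotE : ∀ j, j < N → Q.eraseLead.coeff j = 0 := by
        intro j hj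
        rw [eraseLead_coeff]
        split_ifs
        · rfl
        · exact hbot j hj
      have hEcard : Q.eraseLead.support.card ≤ n := by
        have := eraseLead_support_card_lt hQ0
        omega
      have hE := ih Q.eraseLead N hEcard hnnE hbotE
      rw [signVariations_eq_eraseLead_add_ite hQ0, sign_pos hlc]
      by_cases hE0 : Q.eraseLead = 0
      · rw [hE0, signVariations_zero, leadingCoeff_zero, sign_zero, if_neg (by decide)]
        exact zero_le_one
      by_cases hdegE : Q.eraseLead.natDegree ≤ N
      · -- `eraseLead Q` is a monomial: no variation of its own
        have hmono : Q.eraseLead = monomial N (Q.eraseLead.coeff N) := by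
          ext i
          rw [coeff_monomial]
          split_ifs with hi
          · rw [hi]
          · rcases lt_or_gt_of_ne (Ne.symm hi) with hlt | hgt
            · exact hbotE i hlt
            · exact coeff_eq_zero_of_natDegree_lt (lt_of_le_of_lt hdegE hgt)
        rw [hmono, signVariations_monomial]
        split_ifs <;> simp
      · push Not at hdegE
        have hlcE : 0 < Q.eraseLead.leadingCoeff :=
          lt_of_le_of_ne (hnnE _ hdegE.ne') (Ne.symm (leadingCoeff_ne_zero.mpr hE0))
        rw [sign_pos hlcE, if_neg (by decide), add_zero]
        exact hE

/-- **At most one negative coefficient ⇒ at most two sign variations.** [folklore] -/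
theorem signVariations_le_two_of_coeff_nonneg_off :
    ∀ (n : ℕ) (Q : ℝ[X]) (N : ℕ), Q.support.card ≤ n → (∀ i, i ≠ N → 0 ≤ Q.coeff i) →
      Q.signVariations ≤ 2 := by
  intro n
  induction n with
  | zero =>
    intro Q N hQ _
    have h0 : Q = 0 := Polynomial.card_support_eq_zero.mp (by omega)
    rw [h0, signVariations_zero]
    exact Nat.zero_le _
  | succ n ih =>
    intro Q N hQ hnn
    by_cases hQ0 : Q = 0
    · rw [hQ0, signVariations_zero]
      exact Nat.zero_le _
    by_cases htop : ∀ i, N < i → Q.coeff i = 0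
    · exact (signVariations_le_one_of_top Q N hnn htop).trans one_le_two
    push Not at htop
    obtain ⟨i, hNi, hi⟩ := htop
    have hdeg : N < Q.natDegree := lt_of_lt_of_le hNi (le_natDegree_of_ne_zero hi)
    have hlc : 0 < Q.leadingCoeff :=
      lt_of_le_of_ne (hnn _ hdeg.ne') (Ne.symm (leadingCoeff_ne_zero.mpr hQ0))
    have hnnE : ∀ j, j ≠ N → 0 ≤ Q.eraseLead.coeff j := by
      intro j hj
      rw [eraseLead_coeff]
      split_ifs
      · exact le_rfl
      · exact hnn j hj
    have hEcard : Q.eraseLead.support.card ≤ n := by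
      have := eraseLead_support_card_lt hQ0
      omega
    rw [signVariations_eq_eraseLead_add_ite hQ0, sign_pos hlc]
    by_cases htop' : ∀ j, N < j → Q.eraseLead.coeff j = 0
    · have h1 := signVariations_le_one_of_top Q.eraseLead N hnnE htop'
      split_ifs <;> omega
    · push Not at htop'
      obtain ⟨j, hNj, hj⟩ := htop'
      have hE0 : Q.eraseLead ≠ 0 := fun h => hj (by rw [h, coeff_zero])
      have hdegE : N < Q.eraseLead.natDegree := lt_of_lt_of_le hNj (le_natDegree_of_ne_zero hj)
      have hlcE : 0 < Q.eraseLead.leadingCoeff :=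
        lt_of_le_of_ne (hnnE _ hdegE.ne') (Ne.symm (leadingCoeff_ne_zero.mpr hE0))
      rw [sign_pos hlcE, if_neg (by decide), add_zero]
      exact ih Q.eraseLead N hEcard hnnE

/-- Descartes: at most one negative coefficient ⇒ at most two positive zeros WITH multiplicity. [folklore] -/
theorem countP_pos_roots_le_two_of_coeff_nonneg_off (Q : ℝ[X]) (N : ℕ) (hnn : ∀ i, i ≠ N → 0 ≤ Q.coeff i) :
    Q.roots.countP (fun t => 0 < t) ≤ 2 :=
  (roots_countP_pos_le_signVariations Q).trans (signVariations_le_two_of_coeff_nonneg_off _ Q N le_rfl hnn)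

/-- Descartes: one possibly negative coefficient at an EXTREME position of the support (nothing below it, or nothing
above it) ⇒ at most ONE positive zero with multiplicity. [folklore] -/
theorem countP_pos_roots_le_one_of_extreme (Q : ℝ[X]) (N : ℕ) (hnn : ∀ i, i ≠ N → 0 ≤ Q.coeff i)
    (hext : (∀ i, i < N → Q.coeff i = 0) ∨ (∀ i, N < i → Q.coeff i = 0)) :
    Q.roots.countP (fun t => 0 < t) ≤ 1 := by
  refine (roots_countP_pos_le_signVariations Q).trans ?_
  rcases hext with h | h
  · exact signVariations_le_one_of_bottom _ Q N le_rfl hnn h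
  · exact signVariations_le_one_of_top Q N hnn h

/-- Descartes: non-negative coefficients ⇒ no positive zero. [folklore] -/
theorem countP_pos_roots_eq_zero_of_coeff_nonneg (Q : ℝ[X]) (hnn : ∀ i, 0 ≤ Q.coeff i) :
    Q.roots.countP (fun t => 0 < t) = 0 := by
  have h := roots_countP_pos_le_signVariations Q
  rw [signVariations_eq_zero_of_coeff_nonneg _ Q le_rfl hnn] at h
  omega

/-! ### Products of fewnomials with non-negative coefficients -/

/-- Coefficients of a product of polynomials with non-negative coefficients are non-negative. [folklore] -/
theorem coeff_prod_nonneg {ι : Type*} (s : Finset ι) (f : ι → ℝ[X])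
    (h : ∀ j ∈ s, ∀ i, 0 ≤ (f j).coeff i) : ∀ i, 0 ≤ (∏ j ∈ s, f j).coeff i := by
  classical
  induction s using Finset.cons_induction with
  | empty =>
    intro i
    rw [prod_empty, coeff_one]
    split_ifs <;> norm_num
  | cons a s ha ih =>
    intro i
    rw [prod_cons, coeff_mul]
    exact Finset.sum_nonneg (fun x _ =>
      mul_nonneg (h a (Finset.mem_cons_self a s) _) (ih (fun j hj => h j (Finset.mem_cons_of_mem hj)) _))

/-- A fewnomial `∑_l a_l X^(d l)` with `a_l ≥ 0` has non-negative coefficients. [folklore] -/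
theorem coeff_fewnomial_nonneg {K : ℕ} (d : Fin K → ℕ) (b : Fin K → ℝ) (hb : ∀ l, 0 ≤ b l) (i : ℕ) :
    0 ≤ (∑ l, C (b l) * X ^ (d l) : ℝ[X]).coeff i := by
  rw [finsetSum_coeff]
  exact Finset.sum_nonneg (fun l _ => by
    rw [coeff_C_mul_X_pow]
    split_ifs
    · exact hb l
    · exact le_rfl)

/-- The coefficients of `∏_j f_j − c X^N` off the index `N` are non-negative when every `a_{jl} ≥ 0`. [folklore] -/
theorem coeff_prod_sub_monomial_nonneg_off {m K : ℕ} (d : Fin K → ℕ) (a : Fin m → Fin K → ℝ) (c : ℝ) (N : ℕ)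
    (ha : ∀ j l, 0 ≤ a j l) (i : ℕ) (hi : i ≠ N) :
    0 ≤ ((∏ j, ∑ l, C (a j l) * X ^ (d l)) - C c * X ^ N : ℝ[X]).coeff i := by
  rw [coeff_sub, coeff_C_mul_X_pow, if_neg hi, sub_zero]
  exact coeff_prod_nonneg _ _ (fun j _ => coeff_fewnomial_nonneg d (a j) (ha j)) i

/-! ### The rung -/

/-- **Positive-coefficient rung, multiplicity currency.**  If every `a_{jl} ≥ 0` then for every real `c` and every
position `N` the polynomial `∏_{j<m} (Σ_l a_{jl} X^(d l)) − c·X^N` has at most TWO positive zeros counted with multiplicity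
(for every `m` and `K`). [this file's theorem; Descartes' rule of signs] -/
theorem countP_pos_roots_prod_sub_monomial_le_two {m K : ℕ} (d : Fin K → ℕ) (a : Fin m → Fin K → ℝ) (c : ℝ) (N : ℕ)
    (ha : ∀ j l, 0 ≤ a j l) :
    ((∏ j, ∑ l, C (a j l) * X ^ (d l)) - C c * X ^ N : ℝ[X]).roots.countP (fun t => 0 < t) ≤ 2 :=
  countP_pos_roots_le_two_of_coeff_nonneg_off _ N (coeff_prod_sub_monomial_nonneg_off d a c N ha)

/-- **Positive-coefficient rung, distinct-zero currency** (the card's `Z₊ ≤ 2`, for every scale `c` and position `N`).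
[this file's theorem] -/
theorem card_pos_roots_prod_sub_monomial_le_two {m K : ℕ} (d : Fin K → ℕ) (a : Fin m → Fin K → ℝ) (c : ℝ) (N : ℕ)
    (ha : ∀ j l, 0 ≤ a j l) :
    (((∏ j, ∑ l, C (a j l) * X ^ (d l)) - C c * X ^ N : ℝ[X]).roots.toFinset.filter (fun t => 0 < t)).card ≤ 2 :=
  (StubVLawTwo.card_filter_pos_le_countP _).trans (countP_pos_roots_prod_sub_monomial_le_two d a c N ha)

/-- **Sharp bottom case (`N = 0`, the sketch's shape): at most ONE positive zero with multiplicity** — `∏_j f_j − c` with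
every `a_{jl} ≥ 0` (every real `c`): the negative coefficient sits at the bottom of the support. [this file's theorem] -/
theorem countP_pos_roots_prod_sub_C_le_one {m K : ℕ} (d : Fin K → ℕ) (a : Fin m → Fin K → ℝ) (c : ℝ)
    (ha : ∀ j l, 0 ≤ a j l) :
    ((∏ j, ∑ l, C (a j l) * X ^ (d l)) - C c : ℝ[X]).roots.countP (fun t => 0 < t) ≤ 1 := by
  have h := countP_pos_roots_le_one_of_extreme ((∏ j, ∑ l, C (a j l) * X ^ (d l)) - C c * X ^ 0 : ℝ[X]) 0
    (coeff_prod_sub_monomial_nonneg_off d a c 0 ha) (Or.inl (fun i hi => absurd hi (Nat.not_lt_zero i)))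
  rwa [pow_zero, mul_one] at h

/-- **The other sign: no positive zero.**  If every `a_{jl} ≥ 0` and `c ≥ 0` then `∏_j f_j + c·X^N` has no positive zero.
[this file's theorem] -/
theorem countP_pos_roots_prod_add_monomial_eq_zero {m K : ℕ} (d : Fin K → ℕ) (a : Fin m → Fin K → ℝ) (c : ℝ) (N : ℕ)
    (ha : ∀ j l, 0 ≤ a j l) (hc : 0 ≤ c) :
    ((∏ j, ∑ l, C (a j l) * X ^ (d l)) + C c * X ^ N : ℝ[X]).roots.countP (fun t => 0 < t) = 0 := by
  refine countP_pos_roots_eq_zero_of_coeff_nonneg _ (fun i => ?_)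
  rw [coeff_add, coeff_C_mul_X_pow]
  refine add_nonneg (coeff_prod_nonneg _ _ (fun j _ => coeff_fewnomial_nonneg d (a j) (ha j)) i) ?_
  split_ifs
  · exact hc
  · exact le_rfl

/-- Distinct-zero form of `countP_pos_roots_prod_add_monomial_eq_zero`. [this file's theorem] -/
theorem card_pos_roots_prod_add_monomial_eq_zero {m K : ℕ} (d : Fin K → ℕ) (a : Fin m → Fin K → ℝ) (c : ℝ) (N : ℕ)
    (ha : ∀ j l, 0 ≤ a j l) (hc : 0 ≤ c) :
    (((∏ j, ∑ l, C (a j l) * X ^ (d l)) + C c * X ^ N : ℝ[X]).roots.toFinset.filter (fun t => 0 < t)).card = 0 := by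
  have h := StubVLawTwo.card_filter_pos_le_countP ((∏ j, ∑ l, C (a j l) * X ^ (d l)) + C c * X ^ N : ℝ[X])
  rw [countP_pos_roots_prod_add_monomial_eq_zero d a c N ha hc] at h
  omega

/-- **`PosCoeffRung`** — the sketch's S3 statement VERBATIM (`Cruxes/MatrixDescartes/IDEATION_f_g0_ProductPlusOne_PowerSector.lean`,
`ProductPlusOne.PosCoeffRung`, with `fewnomial d (a j)` unfolded to `∑ l, C (a j l) * X ^ (d l)`): if every `f_j` has
non-negative coefficients then `∏ f_j − c` (`c > 0`) has at most two positive zeros — for EVERY `m` and `K`.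
(The hypothesis `0 < c` is not used: the bound holds for every real `c`.) [this file's theorem] -/
theorem posCoeffRung : ∀ (m K : ℕ) (d : Fin K → ℕ) (a : Fin m → Fin K → ℝ) (c : ℝ), (∀ j l, 0 ≤ a j l) → 0 < c →
    ((∏ j, (∑ l, C (a j l) * X ^ (d l) : ℝ[X]) - C c).roots.toFinset.filter (fun t => 0 < t)).card ≤ 2 := by
  intro m K d a c ha _
  have h := card_pos_roots_prod_sub_monomial_le_two d a c 0 ha
  rwa [pow_zero, mul_one] at h

end ProductPlusOne

end Summit.ValiantsHypothesis.ValiantsHypothesis.Theorems.LacunarySymmetroidMatrixDescartes
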